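import Summits.HodgeConjecture.HodgeConjecture.Theses.HeckePrymWeil
import Literature.AlgebraicGeometry.Motives.AbelianVarietyProjectiveChart
import Summits.HodgeConjecture.HodgeConjecture.Theorems.WeilTwelvefoldsSqrtMinus7.Negative.EigenvalueTyping
import Summits.HodgeConjecture.HodgeConjecture.Theorems.WeilTwelvefoldsSqrtMinus7.Negative.WeilPlaneReality
import Summits.HodgeConjecture.HodgeConjecture.Theorems.WeilTwelvefoldsSqrtMinus7.Negative.DiscriminantClasses
import Summits.HodgeConjecture.HodgeConjecture.Theorems.WeilSixfoldsSqrtMinus7.Negative.EigenvalueSeparation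

/-!
# Disproof attempts on crux `HyperbolicEightfoldsSqrtMinus7` (stmt-HodgeConjecture-14642, route HeckePrymWeil) — findings

Work file of the standing disprover `refuter-cdisprove-stmt-HodgeConjecture-14642-0` (cycle 1, 2026-08-16).
Everything below is `lean check`ed (rc 0, no `sorry`); prose only in docstrings.  Imports the landed negative
lemmas of the sibling cruxes (`Theorems/WeilTwelvefoldsSqrtMinus7/Negative/*`, `WeilSixfoldsSqrtMinus7/Negative/
EigenvalueSeparation`) instead of redoing them; consistent with the one-shot attack already on the item
(refuter-rattack, CRUX-ATTACK.md + W.lean, 2026-08-16T04:37Z: SURVIVES).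

## Verdict: NO KILL — and none is possible in the present tree

READING (§0, `crux_iff`, definitional).  For every complex abelian variety `A` (`Motives.AbelianVariety ℂ`, a
real definition: proper geometrically-integral group scheme over `Spec ℂ`) with `A.dim = 8`, every `φ : A ⟶ A`
with `φ ≫ φ = -7` (preadditive structure = pointwise sum of homomorphisms), every CLOSED IMMERSION
`e.ι : A.X ⟶ ℙᴺ` (`ProjectiveEmbedding` carries `IsClosedImmersion`), every rational `a ≠ 0` in `H²(ℙᴺ(ℂ); ℂ)`,
IF `(A, φ)` is hyperbolic for `h = 7·ι^*a + φ^*ι^*a` (`IsHyperbolicWeilType A φ 4 h`: 8 rational,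
`ℂ`-independent classes of `H¹` spanning a `φ^*`-stable subspace, pairwise isotropic for `h⁷ ⌣ (· ⌣ ·)`),
THEN every rational class `c ∈ H⁸(A(ℂ); ℂ)` of Hodge type `(4,4)` lying in
`Eig((𝟙+φ)^*, (1+i√7)⁸) ⊔ Eig((𝟙+φ)^*, (1-i√7)⁸)` is in `algebraicClasses A.X 4 = N⁴H⁸`.
Quantifier shape `∀ e a, … → hyperbolic → ∀ c …` = "`(∃ polarization-type class h making (A,φ) split) → all
Weil classes algebraic`", as intended.  `h = q·(7L + φ^*L)`, `L = c₁(ι^*O(1))` very ample, `φ` finite, so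
`h = ±`(ample class) and `φ^*h = 7h` (§3(c), modulo `[-7]^* = 49` on `H²`): a `φ`-compatible polarization up
to sign and `ℚ^×_{>0}`; every `φ`-compatible polarization arises (`L = mE`).  Typing of the plane faithful in
degree 8 (§2: `(1±i√7)⁸ = -3968 ∓ 384·i√7` distinct, no mixed collision `mixed_eight`, rational operator
identity `mem_weilPlane8_iff`: `T² + 7936T + 8⁸`).

1. SUMMIT-HARDNESS (§1, unconditional).  `RungEight` := the all-discriminant eightfold statement `HWA(7,4)`.
   `of_rungEight : RungEight → crux`; `rungEight_of_hodgeConjecture` (abelian varieties are smooth projective —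
   PROVED in the tree); `rungEight_of_ladder : HodgeWeilLadder → WeilDescending → RungEight` (rung (7,3) + two
   descents; 8 is not a rung dimension `6(g′-1)`); `rungEight_of_twelvefolds`.  Contrapositives
   `not_hodgeConjecture_of_not`, `not_ladder_of_not`, `not_twelvefolds_of_not`: a kill of this crux kills the
   Clay problem, the route target, and the sibling crux stmt-1261; by André 1996 (barrier
   `Andre1996_hodgeClassesOnAbelianVarieties_motivated`) also standard conjecture B.  Glue re-verified:
   `not_crux_of_not_sixfolds : ¬WeilSixfoldsSqrtMinus7 → AimedDescending → ¬crux` (the crux's hypothesis block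
   unifies with the lever's antecedent at `(7,3)`; the child is STRONGER than the parent it decides, by design).
2. NO MODEL (as for every Weil crux): the only constructible `AbelianVariety ℂ` is `Spec ℂ` (`dim 0`); no
   `¬ ∀ A, A.dim = 8 → …` has a Lean witness today.  Hence §3 is written as exact logical relations + witness
   hypotheses, never as unconditional `_false_without_` theorems.
3. LOAD-BEARING ANALYSIS (§3).
   (a) `a ≠ 0`: load-bearing for SCOPE, not truth.  `cruxWithoutANeZero_iff : (crux minus a≠0) ↔ crux ∧
       FrameVariant` (EXACT, Lean): `a = 0 ⇒ h = 0 ⇒` "hyperbolic" `=` mere existence of a rational `φ^*`-stable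
       8-frame (`isHyperbolicWeilType_zero_class_iff`), which every Weil eightfold has; so deleting `a ≠ 0`
       silently re-admits every discriminant (`cruxWithoutANeZero_iff_rungEight`, modulo frame existence).
   (b) normalisation: `h(e, q•a) = q•h(e,a)` and `isHyperbolicWeilType_symClass_smul_iff` — only `a ≠ 0`
       matters; sign of `a` invisible (covers `±` polarization alike; consistent).
   (c) `φ`-compatibility `φ^*h = 7h` (`map_symClass_eq_seven_smul`, modulo `[-7]^*|H² = 49`).
   (d) `IsOfHodgeType (4,4)`: REDUNDANT on paper GIVEN hyperbolicity — NEW w.r.t. the sixfold crux (there it is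
       load-bearing, `E⁶`).  Hodge–Riemann on `H¹` + the abstract core PROVED here,
       `finrank_eq_of_isotropic_half` (a half-dimensional subspace on which a form positive on `P∖0`, negative
       on `N∖0` vanishes forces `dim P = dim N`): a rational Lagrangian `K`-stable 8-frame forces Weil signature
       `(4,4)`, so the typed plane is entirely `(4,4)`.  Recorded as `SignatureForcing` (precise `Prop`) with
       `cruxWithoutHodgeType_iff`.  Consequently NO off-type pair (`E⁸`, `diag √-7`) satisfies the hypotheses:
       the minimal falsifying mutation is the PAIR {drop IsOfHodgeType, drop hyperbolicity/`a≠0`/closed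
       immersion} — `rungEightWithoutHodgeType_false_of_witness` (modulo `CMEightfoldNonHodgeWeilWitness`).
       CAUTION (d′): this is specific to the EMBEDDED `h(e,a) = ±`ample; for the parent line's Stub 1 typing
       (`h ∈ N¹H²`, `Q_h` non-degenerate, not necessarily ample) the Hodge-type clause IS load-bearing —
       `stubOneWithoutHodgeType_false_of_witness` (E⁸ with an INDEFINITE hyperbolic divisor class `h_M`).
   (e) hyperbolicity dropped ⇒ `RungEight` (`cruxWithoutHyperbolic_iff_rungEight`, modulo `H²(ℙᴺ;ℚ) ≠ 0`); the
       restriction is GENUINE: `three_not_norm` (`3 ∉ Nm ℚ(√-7)^×`, descent at the inert prime 3) — the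
       component `det H ≡ 3` of Weil eightfolds is outside the crux; infinitely many such
       (`discriminantClasses_infinite`, imported).
   (f) `IsRationalClass c`: not load-bearing (plane defined over `ℚ`, `mem_weilPlane8_iff`; `algebraicClasses`
       a `ℂ`-subspace).  `⊔` ESSENTIAL: `onlyPlusVariant_holds` / `onlyMinusVariant_holds` (single-eigenspace
       variants hold VACUOUSLY, no other hypothesis needed); `crux_iff_componentwise` (a counterexample class has
       two non-zero, non-rational, conjugate components, `weilComponents8_ne_zero`); "one non-zero algebraic
       class per `(A,φ)` suffices": `weilComponents8_algebraic_of_algebraic` (modulo `(𝟙+φ)^*`-stability of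
       algebraic classes = flat pull-back).
   (g) `A.dim = 8`, `φ ≫ φ = -7`: not load-bearing for truth (each weakening is still a set of HC instances),
       only for the route's mechanism.
4. NATURAL STRENGTHENINGS: all-δ eightfolds (`RungEight`) — open HC instance, not refutable; drop `(4,4)` AND
   polarization — false (E⁸); `+`/`-` only — vacuous; `K = ℚ(√-3)`/`ℚ(i)` analogues in dim 8 — open as well
   (Schoen reaches sixfolds); dim-6 split analogue — TRUE (Markman 2025 Thm 1.5.1), dim ≥ 8 nothing in print.
5. LITERATURE / BARRIERS: status as in the item (Markman arXiv:2502.03415 §1.2: secant variety proper for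
   `n ≥ 4`; arXiv:2603.20268 §1; arXiv:2607.18341 intro: HC for AV of dim ≤ 5); `Weil1977_exceptional…` and
   `Mumford1968_…` apply (exceptional ≠ non-algebraic); `Andre1996_…` blocks refutation.  Ledger negatives for
   HodgeConjecture: unrelated (DerivedTorelliFermatK3Exhaustion, ELineConnectivity).
6. PARENT STUB (§4): the crux "= Stub 1 of `Lines/hyperbolic-eightfold-descent` up to the polarization
   typing" costs exactly three tree facts for `h(e,a)` — (N1) `∈ N¹H²`, (C) `φ^*h = 7h`, (ND) `Q_h`
   non-degenerate: `crux_of_stubOne`; the converse is not formal (Stub 1's `h` is more general).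
7. TARGETS: none (`payload.targets = []`, no line picked for this crux).  §5 is reserved; on re-arm extend here.

Provers: cite §1 for the reductions, §2 for the plane bookkeeping in degree 8, §3(d) for "the (4,4) typing is
free".  Planners: no misstatement; no signature change recommended; note 3(a) if the `a ≠ 0` clause is ever
edited, and 3(d) (the Hodge-type clause could be dropped without changing the statement's content).
-/

noncomputable section

set_option linter.dupNamespace false

open CategoryTheory Complex
open Literature.AlgebraicGeometry Literature.AlgebraicGeometry.HodgeTheory
open Literature.AlgebraicTopology.SingularHomology
open Summit.HodgeConjecture.HodgeConjecture.Theses.HeckePrymWeil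

namespace Summit.HodgeConjecture.HodgeConjecture.Cruxes.HyperbolicEightfoldsSqrtMinus7.Disproof

/-! ## §0 The crux elaborates; abbreviations -/

/-- The crux, restated by name (elaboration probe; the body is the route decl verbatim). -/
example : HyperbolicEightfoldsSqrtMinus7 ↔
    ∀ (A : Motives.AbelianVariety ℂ) (φ : A ⟶ A), A.dim = 8 → φ ≫ φ = -((7 : ℤ) • 𝟙 A) →
      ∀ (e : Motives.ProjectiveEmbedding A.X)
        (a : complexBetti (Motives.projectiveSpace e.n ℂ) 2), IsRationalClass a → a ≠ 0 →
        Motives.IsHyperbolicWeilType A φ 4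
          ((7 : ℂ) • complexBetti.map e.ι 2 a + complexBetti.map φ.hom.hom.hom 2 (complexBetti.map e.ι 2 a)) →
      ∀ c : complexBetti A.X 8, IsRationalClass c → IsOfHodgeType 8 A.X 8 4 4 c →
        c ∈ Module.End.eigenspace (complexBetti.map (𝟙 A + φ).hom.hom.hom 8).hom
              ((1 + I * (Real.sqrt (7 : ℝ) : ℂ)) ^ 8) ⊔
            Module.End.eigenspace (complexBetti.map (𝟙 A + φ).hom.hom.hom 8).hom
              ((1 - I * (Real.sqrt (7 : ℝ) : ℂ)) ^ 8) →
        c ∈ algebraicClasses A.X 4 :=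
  Iff.rfl

variable (A : Motives.AbelianVariety ℂ) (φ : A ⟶ A)

/-- The K-symmetrised hyperplane class `h(e, a) = 7·ι^*a + φ^*ι^*a` of the crux. -/
abbrev symClass (e : Motives.ProjectiveEmbedding A.X) (a : complexBetti (Motives.projectiveSpace e.n ℂ) 2) :
    complexBetti A.X 2 :=
  (7 : ℂ) • complexBetti.map e.ι 2 a + complexBetti.map φ.hom.hom.hom 2 (complexBetti.map e.ι 2 a)

/-- The typed Weil plane of the crux in degree 8: `Eig((𝟙+φ)^*, (1+i√7)⁸) ⊔ Eig((𝟙+φ)^*, (1-i√7)⁸)`. -/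
abbrev weilPlane8 : Submodule ℂ (complexBetti A.X 8) :=
  Module.End.eigenspace (complexBetti.map (𝟙 A + φ).hom.hom.hom 8).hom ((1 + I * (Real.sqrt (7 : ℝ) : ℂ)) ^ 8) ⊔
    Module.End.eigenspace (complexBetti.map (𝟙 A + φ).hom.hom.hom 8).hom ((1 - I * (Real.sqrt (7 : ℝ) : ℂ)) ^ 8)

/-- The crux in abbreviated form (definitional). -/
theorem crux_iff : HyperbolicEightfoldsSqrtMinus7 ↔
    ∀ (A : Motives.AbelianVariety ℂ) (φ : A ⟶ A), A.dim = 8 → φ ≫ φ = -((7 : ℤ) • 𝟙 A) →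
      ∀ (e : Motives.ProjectiveEmbedding A.X) (a : complexBetti (Motives.projectiveSpace e.n ℂ) 2),
        IsRationalClass a → a ≠ 0 → Motives.IsHyperbolicWeilType A φ 4 (symClass A φ e a) →
      ∀ c : complexBetti A.X 8, IsRationalClass c → IsOfHodgeType 8 A.X 8 4 4 c →
        c ∈ weilPlane8 A φ → c ∈ algebraicClasses A.X 4 :=
  Iff.rfl

/-- **The all-discriminant eightfold statement** `HWA(7, 4)`: Hodge–Weil classes algebraic on EVERY
ℚ(√-7)-Weil abelian eightfold (no polarization, no hyperbolicity). This is VERBATIM the rung predicate of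
`HodgeWeilLadder` / the consequent of `WeilDescending` at `p = 7, n = 4` (up to the literal casts), and the
crux is its restriction to the split (hyperbolic) components. -/
def RungEight : Prop :=
  ∀ (A : Motives.AbelianVariety ℂ) (φ : A ⟶ A), A.dim = 8 → φ ≫ φ = -((7 : ℤ) • 𝟙 A) →
    ∀ c : complexBetti A.X 8, IsRationalClass c → IsOfHodgeType 8 A.X 8 4 4 c →
      c ∈ weilPlane8 A φ → c ∈ algebraicClasses A.X 4

/-! ## §1 Why it resists: every kill is a kill of something bigger (all unconditional, pure logic) -/

/-- The crux is a weakening of the all-discriminant eightfold statement. -/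
theorem of_rungEight (h : RungEight) : HyperbolicEightfoldsSqrtMinus7 := by
  intro A φ hdim hφ e a _ _ _ c hr hH hW
  exact h A φ hdim hφ c hr hH hW

/-- `RungEight` from the route's target + one support: rung `(7,3)` (dimension 12) and two descents. -/
theorem rungEight_of_ladder (hL : HodgeWeilLadder) (hD : WeilDescending) : RungEight := by
  intro A φ hdim hφ c hr hH hW
  -- rung (p, g) = (7, 3): n = 3 * 2 = 6, dimension 12
  have h12 := hL 7 (by norm_num) (by norm_num) (by norm_num) 3 (by norm_num) 6 (by norm_num)
  -- descend 6 → 5 → 4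
  have h10 := hD 7 (by norm_num) (by norm_num) (by norm_num) 5 (by norm_num)
    (fun m hm => by subst hm; exact h12)
  have h8 := hD 7 (by norm_num) (by norm_num) (by norm_num) 4 (by norm_num)
    (fun m hm => by subst hm; exact h10)
  have := h8 A φ hdim (by exact_mod_cast hφ) c hr hH
  exact this (by exact_mod_cast hW)

/-- `RungEight` from the sibling crux `WeilTwelvefoldsSqrtMinus7` (= rung (7,3)) and `WeilDescending`. -/
theorem rungEight_of_twelvefolds (h12 : WeilTwelvefoldsSqrtMinus7) (hD : WeilDescending) : RungEight := by
  intro A φ hdim hφ c hr hH hW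
  have h10 := hD 7 (by norm_num) (by norm_num) (by norm_num) 5 (by norm_num)
    (fun m hm A' φ' hdim' hφ' c' hr' hH' hW' => by
      subst hm
      exact h12 A' φ' hdim' (by exact_mod_cast hφ') c' hr' hH' (by exact_mod_cast hW'))
  have h8 := hD 7 (by norm_num) (by norm_num) (by norm_num) 4 (by norm_num)
    (fun m hm => by subst hm; exact h10)
  have := h8 A φ hdim (by exact_mod_cast hφ) c hr hH
  exact this (by exact_mod_cast hW)

/-- `RungEight` (hence the crux) is an instance of the Hodge conjecture: abelian varieties are smooth
projective (the tree's PROVED `AbelianVariety.isSmoothProjective_holds`). -/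
theorem rungEight_of_hodgeConjecture (hHC : _root_.HodgeConjecture) : RungEight := by
  intro A φ hdim _ c hr hH _
  have hsp : Motives.IsSmoothProjective 8 A.X := by
    have h := (Motives.AbelianVariety.isSmoothProjective_holds (A := A))
    rw [Motives.AbelianVariety.isSmoothProjective, hdim] at h
    exact h
  exact (hHC hsp).2 4 c hr hH

/-- **Summit-hardness (unconditional):** a refutation of the crux refutes the Clay problem. -/
theorem not_hodgeConjecture_of_not (h : ¬ HyperbolicEightfoldsSqrtMinus7) : ¬ _root_.HodgeConjecture :=
  fun hHC => h (of_rungEight (rungEight_of_hodgeConjecture hHC))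

/-- A refutation of the crux refutes the conjunction target ∧ support of its own route. -/
theorem not_ladder_of_not (h : ¬ HyperbolicEightfoldsSqrtMinus7) (hD : WeilDescending) : ¬ HodgeWeilLadder :=
  fun hL => h (of_rungEight (rungEight_of_ladder hL hD))

/-- A refutation of the crux refutes the sibling crux `WeilTwelvefoldsSqrtMinus7` (given `WeilDescending`). -/
theorem not_twelvefolds_of_not (h : ¬ HyperbolicEightfoldsSqrtMinus7) (hD : WeilDescending) :
    ¬ WeilTwelvefoldsSqrtMinus7 :=
  fun h12 => h (of_rungEight (rungEight_of_twelvefolds h12 hD))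

/-- **Glue re-verification** (the planner's `weilSixfoldsSqrtMinus7_of_eightfolds`): the crux's hypothesis
block unifies with the antecedent of the lever `AimedDescending` at `(p, n) = (7, 3)`, so crux + lever give the
parent crux `WeilSixfoldsSqrtMinus7` (all discriminants). Contrapositive (negative) form. -/
theorem not_crux_of_not_sixfolds (h6 : ¬ WeilSixfoldsSqrtMinus7) (hAD : AimedDescending) :
    ¬ HyperbolicEightfoldsSqrtMinus7 := by
  intro h8
  apply h6
  intro A φ hdim hφ c hr hH hW
  have h := hAD 7 (by norm_num) (by norm_num) (by norm_num) 3 (by norm_num)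
    (fun m hm A' φ' hdim' hφ' e a ha ha0 hyp c' hr' hH' hW' => by
      subst hm
      exact h8 A' φ' hdim' (by exact_mod_cast hφ') e a ha ha0 (by exact_mod_cast hyp) c' hr' hH'
        (by exact_mod_cast hW'))
  have := h A φ hdim (by exact_mod_cast hφ) c hr hH
  exact this (by exact_mod_cast hW)


/-! ## §2 Typing of the Weil plane in degree 8: faithful, `⊔` essential, componentwise form -/

section Typing

open Summit.HodgeConjecture.HodgeConjecture.Theorems.WeilTwelvefoldsSqrtMinus7.Negative
  (one_add_I_sqrt7_pow_ne mixed_eq_plus_iff mixed_eq_minus_iff one_add_I_sqrt7_pow one_sub_I_sqrt7_pow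
    conj_one_add_I_sqrt7_pow conj_one_sub_I_sqrt7_pow eq_zero_of_isRationalClass_of_mem_eigenspace
    conjClass_mem_eigenspace_map eq_zero_of_mem_eigenspace_of_mem_eigenspace components_mem_span_pair)
open Summit.HodgeConjecture.HodgeConjecture.Theorems.WeilSixfoldsSqrtMinus7.Negative
  (mem_eigenspace_sup_eigenspace_iff)

/-- `(1+i√7)⁸ ≠ (1-i√7)⁸`: the `⊔` of the crux is a DIRECT sum of two distinct eigenspaces of `(𝟙+φ)^*`.
[folklore] -/
theorem weilEigenvalues_eight_ne :
    (1 + I * (Real.sqrt (7 : ℝ) : ℂ)) ^ 8 ≠ (1 - I * (Real.sqrt (7 : ℝ) : ℂ)) ^ 8 :=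
  one_add_I_sqrt7_pow_ne 8 (by norm_num)

/-- `(1+√-7)⁸ = -3968 - 384·√-7` in `ℤ[√-7]` (kernel computation; `3968² + 7·384² = 8⁸`). [folklore] -/
theorem one_add_sqrtNeg7_pow_eight : (⟨1, 1⟩ : ℤ√(-7)) ^ 8 = ⟨-3968, -384⟩ := by decide

/-- **Explicit typed eigenvalue** `(1+i√7)⁸ = -3968 - 384·i√7`. [folklore] -/
theorem one_add_I_sqrt7_pow_eight :
    (1 + I * (Real.sqrt (7 : ℝ) : ℂ)) ^ 8 = (-3968 : ℂ) - (384 : ℂ) * (I * (Real.sqrt (7 : ℝ) : ℂ)) := by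
  rw [one_add_I_sqrt7_pow, one_add_sqrtNeg7_pow_eight]; push_cast; ring

/-- `(1-i√7)⁸ = -3968 + 384·i√7`. [folklore] -/
theorem one_sub_I_sqrt7_pow_eight :
    (1 - I * (Real.sqrt (7 : ℝ) : ℂ)) ^ 8 = (-3968 : ℂ) + (384 : ℂ) * (I * (Real.sqrt (7 : ℝ) : ℂ)) := by
  rw [one_sub_I_sqrt7_pow, one_add_sqrtNeg7_pow_eight]; push_cast; ring

/-- **No mixed Künneth–Hodge summand `∧ᵃH¹_σ ⊗ ∧ᵇH¹_σ̄` (`a + b = 8`) carries a Weil eigenvalue** except the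
two pure ends: the hypothesis `c ∈ Eig ⊔ Eig` cuts out exactly `W_K ⊗ ℂ = ∧⁸H¹_σ ⊕ ∧⁸H¹_σ̄` (granted
`H⁸(A) = ∧⁸H¹(A)`). [folklore] -/
theorem mixed_eight (a b : ℕ) (hab : a + b = 8) :
    ((1 + I * (Real.sqrt (7 : ℝ) : ℂ)) ^ a * (1 - I * (Real.sqrt (7 : ℝ) : ℂ)) ^ b =
        (1 + I * (Real.sqrt (7 : ℝ) : ℂ)) ^ 8 ↔ b = 0) ∧
    ((1 + I * (Real.sqrt (7 : ℝ) : ℂ)) ^ a * (1 - I * (Real.sqrt (7 : ℝ) : ℂ)) ^ b =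
        (1 - I * (Real.sqrt (7 : ℝ) : ℂ)) ^ 8 ↔ a = 0) := by
  rw [← hab]
  exact ⟨mixed_eq_plus_iff a b, mixed_eq_minus_iff a b⟩

/-- **The typed plane is cut out by a RATIONAL operator identity**: for `f = (𝟙+φ)^*` on `H⁸`,
`x ∈ Eig(f, λ⁸) ⊔ Eig(f, λ̄⁸) ↔ f(f x) + 7936·f x + 16777216·x = 0` (`λ⁸ + λ̄⁸ = -7936`, `λ⁸λ̄⁸ = 8⁸`);
`T² + 7936·T + 8⁸ ∈ ℤ[T]` is irreducible over `ℚ` (discriminant `-7·768²`), so the plane is defined over `ℚ`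
and `ℂ`-spanned by rational classes — why `IsRationalClass c` is not load-bearing (§3). [folklore] -/
theorem mem_weilPlane8_iff {V : Type*} [AddCommGroup V] [Module ℂ V] (f : Module.End ℂ V) (x : V) :
    x ∈ f.eigenspace ((1 + I * (Real.sqrt (7 : ℝ) : ℂ)) ^ 8) ⊔ f.eigenspace ((1 - I * (Real.sqrt (7 : ℝ) : ℂ)) ^ 8) ↔
      f (f x) + (7936 : ℂ) • f x + (16777216 : ℂ) • x = 0 := by
  have ht := Theorems.WeilSixfoldsSqrtMinus7.Negative.I_mul_sqrt_seven_sq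
  have hsum : (1 + I * (Real.sqrt (7 : ℝ) : ℂ)) ^ 8 + (1 - I * (Real.sqrt (7 : ℝ) : ℂ)) ^ 8 = -7936 := by
    rw [one_add_I_sqrt7_pow_eight, one_sub_I_sqrt7_pow_eight]; ring
  have hprod : (1 + I * (Real.sqrt (7 : ℝ) : ℂ)) ^ 8 * (1 - I * (Real.sqrt (7 : ℝ) : ℂ)) ^ 8 = 16777216 := by
    rw [one_add_I_sqrt7_pow_eight, one_sub_I_sqrt7_pow_eight]
    linear_combination (-147456 : ℂ) * ht
  rw [mem_eigenspace_sup_eigenspace_iff f weilEigenvalues_eight_ne, hsum, hprod, neg_smul, sub_neg_eq_add]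

/-- `conj((1+i√7)⁸) ≠ (1+i√7)⁸`: the typed eigenvalue is not real. [folklore] -/
theorem conj_weilEigenvalue_eight_ne :
    starRingEnd ℂ ((1 + I * (Real.sqrt (7 : ℝ) : ℂ)) ^ 8) ≠ (1 + I * (Real.sqrt (7 : ℝ) : ℂ)) ^ 8 := by
  rw [conj_one_add_I_sqrt7_pow]; exact weilEigenvalues_eight_ne.symm

/-- Mirror. [folklore] -/
theorem conj_weilEigenvalueBar_eight_ne :
    starRingEnd ℂ ((1 - I * (Real.sqrt (7 : ℝ) : ℂ)) ^ 8) ≠ (1 - I * (Real.sqrt (7 : ℝ) : ℂ)) ^ 8 := by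
  rw [conj_one_sub_I_sqrt7_pow]; exact weilEigenvalues_eight_ne

/-- **A rational class in the `+` typed eigenspace ALONE is `0`** (degree 8, every `A`, every `ψ`).
[cite: VoisinHodgeI2002, Cor. 6.12] -/
theorem rational_mem_plusEigenspace8_eq_zero (ψ : A ⟶ A) {c : complexBetti A.X 8} (hr : IsRationalClass c)
    (hc : c ∈ Module.End.eigenspace (complexBetti.map ψ.hom.hom.hom 8).hom ((1 + I * (Real.sqrt (7 : ℝ) : ℂ)) ^ 8)) :
    c = 0 :=
  eq_zero_of_isRationalClass_of_mem_eigenspace _ conj_weilEigenvalue_eight_ne hr hc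

/-- Mirror (`-` eigenspace alone). [cite: VoisinHodgeI2002, Cor. 6.12] -/
theorem rational_mem_minusEigenspace8_eq_zero (ψ : A ⟶ A) {c : complexBetti A.X 8} (hr : IsRationalClass c)
    (hc : c ∈ Module.End.eigenspace (complexBetti.map ψ.hom.hom.hom 8).hom ((1 - I * (Real.sqrt (7 : ℝ) : ℂ)) ^ 8)) :
    c = 0 :=
  eq_zero_of_isRationalClass_of_mem_eigenspace _ conj_weilEigenvalueBar_eight_ne hr hc

/-- **Refuted-as-vacuous strengthening of the typing (`+` only)**: the variant of the crux keeping only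
`Eig((𝟙+φ)^*, (1+i√7)⁸)` holds outright (every admissible class is `0`) — the `⊔` is essential; this variant
needs none of the other hypotheses. [folklore] -/
theorem onlyPlusVariant_holds :
    ∀ (A : Motives.AbelianVariety ℂ) (φ : A ⟶ A) (c : complexBetti A.X 8), IsRationalClass c →
      c ∈ Module.End.eigenspace (complexBetti.map (𝟙 A + φ).hom.hom.hom 8).hom ((1 + I * (Real.sqrt (7 : ℝ) : ℂ)) ^ 8) →
      c ∈ algebraicClasses A.X 4 := by
  intro A φ c hr hc
  rw [rational_mem_plusEigenspace8_eq_zero A _ hr hc]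
  exact Submodule.zero_mem _

/-- Mirror (`-` only). [folklore] -/
theorem onlyMinusVariant_holds :
    ∀ (A : Motives.AbelianVariety ℂ) (φ : A ⟶ A) (c : complexBetti A.X 8), IsRationalClass c →
      c ∈ Module.End.eigenspace (complexBetti.map (𝟙 A + φ).hom.hom.hom 8).hom ((1 - I * (Real.sqrt (7 : ℝ) : ℂ)) ^ 8) →
      c ∈ algebraicClasses A.X 4 := by
  intro A φ c hr hc
  rw [rational_mem_minusEigenspace8_eq_zero A _ hr hc]
  exact Submodule.zero_mem _

/-- **The two components of a rational class of the typed plane are conjugate** (degree 8).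
[cite: VoisinHodgeI2002, Cor. 6.12] -/
theorem weilComponents8_conj (ψ : A ⟶ A) {c cp cm : complexBetti A.X 8} (hr : IsRationalClass c)
    (hp : cp ∈ Module.End.eigenspace (complexBetti.map ψ.hom.hom.hom 8).hom ((1 + I * (Real.sqrt (7 : ℝ) : ℂ)) ^ 8))
    (hm : cm ∈ Module.End.eigenspace (complexBetti.map ψ.hom.hom.hom 8).hom ((1 - I * (Real.sqrt (7 : ℝ) : ℂ)) ^ 8))
    (hc : c = cp + cm) : conjClass _ 8 cp = cm := by
  have hp' := conjClass_mem_eigenspace_map _ hp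
  have hm' := conjClass_mem_eigenspace_map _ hm
  rw [conj_one_add_I_sqrt7_pow] at hp'
  rw [conj_one_sub_I_sqrt7_pow] at hm'
  have hcc : conjClass _ 8 cp + conjClass _ 8 cm = cp + cm := by
    rw [← conjClass_add, ← hc, hr.conjClass_eq]
  have hd1 : conjClass _ 8 cp - cm ∈ Module.End.eigenspace (complexBetti.map ψ.hom.hom.hom 8).hom
      ((1 - I * (Real.sqrt (7 : ℝ) : ℂ)) ^ 8) := Submodule.sub_mem _ hp' hm
  have heq : conjClass _ 8 cp - cm = cp - conjClass _ 8 cm := by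
    rw [sub_eq_sub_iff_add_eq_add, hcc]
  have hd2 : conjClass _ 8 cp - cm ∈ Module.End.eigenspace (complexBetti.map ψ.hom.hom.hom 8).hom
      ((1 + I * (Real.sqrt (7 : ℝ) : ℂ)) ^ 8) := by
    rw [heq]; exact Submodule.sub_mem _ hp hm'
  exact sub_eq_zero.1 (eq_zero_of_mem_eigenspace_of_mem_eigenspace _ weilEigenvalues_eight_ne hd2 hd1)

/-- **Both components of a non-zero rational class of the typed plane are non-zero and non-rational** —
the only shape a counterexample class can have. [folklore] -/
theorem weilComponents8_ne_zero (ψ : A ⟶ A) {c cp cm : complexBetti A.X 8} (hr : IsRationalClass c)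
    (hp : cp ∈ Module.End.eigenspace (complexBetti.map ψ.hom.hom.hom 8).hom ((1 + I * (Real.sqrt (7 : ℝ) : ℂ)) ^ 8))
    (hm : cm ∈ Module.End.eigenspace (complexBetti.map ψ.hom.hom.hom 8).hom ((1 - I * (Real.sqrt (7 : ℝ) : ℂ)) ^ 8))
    (hc : c = cp + cm) (hc0 : c ≠ 0) :
    cp ≠ 0 ∧ cm ≠ 0 ∧ ¬ IsRationalClass cp ∧ ¬ IsRationalClass cm := by
  have hconj := weilComponents8_conj A ψ hr hp hm hc
  have key : IsRationalClass cp → False := fun hxr => by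
    have h0 : cp = 0 := rational_mem_plusEigenspace8_eq_zero A ψ hxr hp
    have h1 := hconj
    rw [h0, conjClass_zero] at h1
    exact hc0 (by rw [hc, h0, ← h1, add_zero])
  have key' : IsRationalClass cm → False := fun hxr => by
    have h0 : cm = 0 := rational_mem_minusEigenspace8_eq_zero A ψ hxr hm
    have h1 := hconj
    rw [h0] at h1
    have h2 : cp = 0 := by
      have := congrArg (conjClass _ 8) h1
      rwa [conjClass_conjClass, conjClass_zero] at this
    exact hc0 (by rw [hc, h0, h2, add_zero])
  exact ⟨fun h0 => key (h0 ▸ IsRationalClass.zero), fun h0 => key' (h0 ▸ IsRationalClass.zero), key, key'⟩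

/-- **The crux is equivalent to its COMPONENTWISE form** (non-zero class with two non-zero conjugate
components) — the only shape in which a counterexample can exist. [folklore] -/
theorem crux_iff_componentwise :
    HyperbolicEightfoldsSqrtMinus7 ↔
    ∀ (A : Motives.AbelianVariety ℂ) (φ : A ⟶ A), A.dim = 8 → φ ≫ φ = -((7 : ℤ) • 𝟙 A) →
      ∀ (e : Motives.ProjectiveEmbedding A.X) (a : complexBetti (Motives.projectiveSpace e.n ℂ) 2),
        IsRationalClass a → a ≠ 0 → Motives.IsHyperbolicWeilType A φ 4 (symClass A φ e a) →
      ∀ c cp cm : complexBetti A.X 8, IsRationalClass c → IsOfHodgeType 8 A.X 8 4 4 c →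
        cp ∈ Module.End.eigenspace (complexBetti.map (𝟙 A + φ).hom.hom.hom 8).hom ((1 + I * (Real.sqrt (7 : ℝ) : ℂ)) ^ 8) →
        cm ∈ Module.End.eigenspace (complexBetti.map (𝟙 A + φ).hom.hom.hom 8).hom ((1 - I * (Real.sqrt (7 : ℝ) : ℂ)) ^ 8) →
        c = cp + cm → cp ≠ 0 → cm ≠ 0 → c ∈ algebraicClasses A.X 4 := by
  constructor
  · intro h A φ hA hφ e a ha ha0 hyp c cp cm hr hH hp hm hc _ _
    exact h A φ hA hφ e a ha ha0 hyp c hr hH (hc ▸ Submodule.add_mem_sup hp hm)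
  · intro h A φ hA hφ e a ha ha0 hyp c hr hH hW
    obtain ⟨cp, hp, cm, hm, hsum⟩ := Submodule.mem_sup.1 hW
    by_cases hc0 : c = 0
    · rw [hc0]; exact Submodule.zero_mem _
    have hne := weilComponents8_ne_zero A _ hr hp hm hsum.symm hc0
    exact h A φ hA hφ e a ha ha0 hyp c cp cm hr hH hp hm hsum.symm hne.1 hne.2.1

/-- **"One non-zero algebraic class per `(A, φ)` suffices" — the Lean half.**  If `(𝟙+φ)^*` preserves
algebraic classes (true: `𝟙+φ` is an isogeny, `(𝟙+φ)(𝟙-φ) = 8`, hence flat — the tree's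
`map_mem_algebraicClasses_of_flat`; assumed here as `hstab`), then the two Weil components of an ALGEBRAIC
class of the typed plane are algebraic (2×2 inversion over `ℚ(λ⁸) ⊂ ℂ`).  With `dim_ℂ Eig(λ⁸) = 1` on a
Weil-type eightfold (not in the tree) this gives `W_K ⊗ ℂ ⊆ algebraicClasses` from ONE non-zero class.
[cite: Markman2025SecantRealMultiplication, §1] -/
theorem weilComponents8_algebraic_of_algebraic (ψ : A ⟶ A)
    (hstab : ∀ x ∈ algebraicClasses A.X 4, complexBetti.map ψ.hom.hom.hom 8 x ∈ algebraicClasses A.X 4)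
    {c cp cm : complexBetti A.X 8}
    (hp : cp ∈ Module.End.eigenspace (complexBetti.map ψ.hom.hom.hom 8).hom ((1 + I * (Real.sqrt (7 : ℝ) : ℂ)) ^ 8))
    (hm : cm ∈ Module.End.eigenspace (complexBetti.map ψ.hom.hom.hom 8).hom ((1 - I * (Real.sqrt (7 : ℝ) : ℂ)) ^ 8))
    (hc : c = cp + cm) (halg : c ∈ algebraicClasses A.X 4) :
    cp ∈ algebraicClasses A.X 4 ∧ cm ∈ algebraicClasses A.X 4 := by
  have h2 := components_mem_span_pair (complexBetti.map ψ.hom.hom.hom 8).hom weilEigenvalues_eight_ne hp hm hc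
  have hle : Submodule.span ℂ {c, (complexBetti.map ψ.hom.hom.hom 8).hom c} ≤ algebraicClasses A.X 4 := by
    rw [Submodule.span_le]
    intro x hx
    rcases hx with rfl | hx
    · exact halg
    · rw [Set.mem_singleton_iff.1 hx]; exact hstab _ halg
  exact ⟨hle h2.1, hle h2.2⟩

end Typing

/-! ## §3 Load-bearing analysis

No hypothesis can be dropped to obtain a Lean-refutable statement (no abelian eightfold is constructible:
`Spec ℂ` is the only `AbelianVariety ℂ` in the tree, of `dim 0`); the analysis is therefore recorded as
exact logical relations between the crux, its weakenings, and precisely stated witness hypotheses. -/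

section LoadBearing

/-! ### (a) `a ≠ 0` — load-bearing for SCOPE only: deleting it re-admits every discriminant -/

/-- `h(e, 0) = 0`. [folklore] -/
theorem symClass_zero (e : Motives.ProjectiveEmbedding A.X) : symClass A φ e 0 = 0 := by
  simp only [symClass, map_zero, smul_zero, add_zero]

/-- The polarization pairing of the ZERO class vanishes in every positive Lefschetz degree:
`Q_{0, j} = 0^j · Q_{0, j} = 0` for `j ≠ 0`. [folklore] -/
theorem polarizationPairingOne_zero_class (X : Motives.SchemeOver ℂ) {j : ℕ} (hj : j ≠ 0)
    (x y : complexBetti X 1) : Motives.polarizationPairingOne X 0 j x y = 0 := by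
  have h := Motives.polarizationPairingOne_smul X (0 : ℂ) (0 : complexBetti X 2) j x y
  rwa [zero_smul, zero_pow hj, zero_smul] at h

/-- Frame-only predicate: `H¹(A(ℂ); ℂ)` contains `2n` rational, `ℂ`-independent classes spanning a
`φ^*`-stable subspace — `IsHyperbolicWeilType` with the isotropy clause deleted.  ALWAYS TRUE on paper for
`A.dim = 2n`, `φ ≫ φ = -d` (`H¹(A, ℚ)` is a `K`-vector space of dimension `2n`; take a `ℚ`-basis of any
`K`-subspace of `K`-dimension `n`), but not provable in the tree (no `dim H¹ = 2·dim A`). [folklore] -/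
def HasRationalStableFrame (n : ℕ) : Prop :=
  ∃ u : Fin (2 * n) → complexBetti A.X 1,
    (∀ i, IsRationalClass (u i)) ∧ LinearIndependent ℂ u ∧
      ∀ i, complexBetti.map φ.hom.hom.hom 1 (u i) ∈ Submodule.span ℂ (Set.range u)

/-- **For the zero class, "hyperbolic" degenerates to mere frame existence**:
`IsHyperbolicWeilType A φ n 0 ↔ HasRationalStableFrame A φ n`. [folklore] -/
theorem isHyperbolicWeilType_zero_class_iff (n : ℕ) :
    Motives.IsHyperbolicWeilType A φ n 0 ↔ HasRationalStableFrame A φ n := by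
  rcases Nat.eq_zero_or_pos n with rfl | hn
  · haveI : IsEmpty (Fin (2 * 0)) := ⟨fun i => Fin.elim0 i⟩
    exact ⟨fun _ => ⟨fun i => Fin.elim0 i, fun i => Fin.elim0 i, linearIndependent_empty_type,
      fun i => Fin.elim0 i⟩, fun _ => Motives.isHyperbolicWeilType_zero A φ 0⟩
  · constructor
    · rintro ⟨u, hr, hli, hst, -⟩
      exact ⟨u, hr, hli, hst⟩
    · rintro ⟨u, hr, hli, hst⟩
      exact ⟨u, hr, hli, hst, fun i j => polarizationPairingOne_zero_class A.X (by omega) _ _⟩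

/-- The crux with the hypothesis `a ≠ 0` DELETED. -/
def CruxWithoutANeZero : Prop :=
  ∀ (A : Motives.AbelianVariety ℂ) (φ : A ⟶ A), A.dim = 8 → φ ≫ φ = -((7 : ℤ) • 𝟙 A) →
    ∀ (e : Motives.ProjectiveEmbedding A.X) (a : complexBetti (Motives.projectiveSpace e.n ℂ) 2),
      IsRationalClass a → Motives.IsHyperbolicWeilType A φ 4 (symClass A φ e a) →
    ∀ c : complexBetti A.X 8, IsRationalClass c → IsOfHodgeType 8 A.X 8 4 4 c →
      c ∈ weilPlane8 A φ → c ∈ algebraicClasses A.X 4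

/-- The instances re-admitted by deleting `a ≠ 0`: every `(A, φ)` carrying a rational `φ^*`-stable 8-frame
of `H¹` — on paper EVERY ℚ(√-7)-Weil eightfold, of every discriminant. -/
def FrameVariant : Prop :=
  ∀ (A : Motives.AbelianVariety ℂ) (φ : A ⟶ A), A.dim = 8 → φ ≫ φ = -((7 : ℤ) • 𝟙 A) →
    HasRationalStableFrame A φ 4 →
    ∀ c : complexBetti A.X 8, IsRationalClass c → IsOfHodgeType 8 A.X 8 4 4 c →
      c ∈ weilPlane8 A φ → c ∈ algebraicClasses A.X 4

/-- Every abelian variety has a projective embedding (the tree's PROVED `isSmoothProjective_holds`). -/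
theorem nonempty_projectiveEmbedding : Nonempty (Motives.ProjectiveEmbedding A.X) :=
  ⟨(Motives.AbelianVariety.isSmoothProjective_holds (A := A)).isProjectiveOver.projectiveEmbedding⟩

/-- **Deleting `a ≠ 0` = crux ∧ FrameVariant** (exact): the binder `a = 0` makes `h = 0`, for which
hyperbolicity is frame existence; so without `a ≠ 0` the statement silently quantifies over the NON-split
eightfolds as well (every discriminant), i.e. it becomes `RungEight` on paper.  `a ≠ 0` is what confines
the crux to the split component; it is not load-bearing for TRUTH (both sides are instances of HC).
[folklore] -/
theorem cruxWithoutANeZero_iff : CruxWithoutANeZero ↔ HyperbolicEightfoldsSqrtMinus7 ∧ FrameVariant := by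
  constructor
  · intro h
    refine ⟨fun A φ hA hφ e a ha _ hyp c hr hH hW => h A φ hA hφ e a ha hyp c hr hH hW, ?_⟩
    intro A φ hA hφ hfr c hr hH hW
    obtain ⟨e⟩ := nonempty_projectiveEmbedding A
    refine h A φ hA hφ e 0 IsRationalClass.zero ?_ c hr hH hW
    rw [symClass_zero, isHyperbolicWeilType_zero_class_iff]
    exact hfr
  · rintro ⟨hcrux, hfr⟩ A φ hA hφ e a ha hyp c hr hH hW
    by_cases ha0 : a = 0
    · subst ha0
      rw [symClass_zero, isHyperbolicWeilType_zero_class_iff] at hyp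
      exact hfr A φ hA hφ hyp c hr hH hW
    · exact hcrux A φ hA hφ e a ha ha0 hyp c hr hH hW

/-- `RungEight ⟹ FrameVariant` (drop the frame). -/
theorem frameVariant_of_rungEight (h : RungEight) : FrameVariant :=
  fun A φ hA hφ _ c hr hH hW => h A φ hA hφ c hr hH hW

/-- Modulo "every ℚ(√-7)-Weil eightfold has a rational `φ^*`-stable 8-frame in `H¹`" (true: `H¹(A, ℚ)` is an
8-dimensional `K`-vector space), `FrameVariant = RungEight`, so `CruxWithoutANeZero ⟺ RungEight`.
[cite: vanGeemen1994HodgeAV, Lemma 5.2] -/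
theorem cruxWithoutANeZero_iff_rungEight
    (hframes : ∀ (A : Motives.AbelianVariety ℂ) (φ : A ⟶ A), A.dim = 8 → φ ≫ φ = -((7 : ℤ) • 𝟙 A) →
      HasRationalStableFrame A φ 4) :
    CruxWithoutANeZero ↔ RungEight := by
  rw [cruxWithoutANeZero_iff]
  constructor
  · rintro ⟨-, hfr⟩ A φ hA hφ c hr hH hW
    exact hfr A φ hA hφ (hframes A φ hA hφ) c hr hH hW
  · intro h
    exact ⟨of_rungEight h, frameVariant_of_rungEight h⟩

/-! ### (b) Normalisation of `a`: only `a ≠ 0` matters (`h(e, q·a) = q·h(e, a)`, isotropy is homogeneous) -/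

/-- `h(e, q • a) = q • h(e, a)`. [folklore] -/
theorem symClass_smul (e : Motives.ProjectiveEmbedding A.X) (q : ℂ) (a : complexBetti (Motives.projectiveSpace e.n ℂ) 2) :
    symClass A φ e (q • a) = q • symClass A φ e a := by
  simp only [symClass, map_smul, smul_add, smul_comm (7 : ℂ) q]

/-- **Rescaling `a` does not change the hypothesis**: for `q ≠ 0`,
`IsHyperbolicWeilType A φ 4 (h(e, q•a)) ↔ IsHyperbolicWeilType A φ 4 (h(e, a))`.  Since `H²(ℙᴺ(ℂ); ℚ) = ℚ·[H]`,
WLOG `a = ±[H]`, and the sign is invisible too: the crux covers `h = +`(ample φ-compatible polarization) and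
`h = -`(same) alike — consistent, isotropy being sign-blind. [folklore] -/
theorem isHyperbolicWeilType_symClass_smul_iff (e : Motives.ProjectiveEmbedding A.X) {q : ℂ} (hq : q ≠ 0)
    (a : complexBetti (Motives.projectiveSpace e.n ℂ) 2) :
    Motives.IsHyperbolicWeilType A φ 4 (symClass A φ e (q • a)) ↔
      Motives.IsHyperbolicWeilType A φ 4 (symClass A φ e a) := by
  rw [symClass_smul, Motives.isHyperbolicWeilType_smul_iff hq]

/-! ### (c) `φ`-compatibility of `h`: `φ^*h = 7h` as soon as `[-7]^* = 49` on `H²` -/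

/-- `φ^* ∘ φ^* = (φ ≫ φ)^*` on `H²` (functoriality of the real pull-back). [folklore] -/
theorem map_map_eq_map_comp (k : ℕ) (x : complexBetti A.X k) :
    complexBetti.map φ.hom.hom.hom k (complexBetti.map φ.hom.hom.hom k x) =
      complexBetti.map (φ ≫ φ).hom.hom.hom k x := by
  have h : (φ ≫ φ).hom.hom.hom = φ.hom.hom.hom ≫ φ.hom.hom.hom := rfl
  rw [h, complexBetti.map_comp, CategoryTheory.comp_apply]

/-- **`h` is `φ`-compatible**: if `[-7]_A^*` acts as `49` on `H²(A(ℂ); ℂ)` (true: `[m]^* = mᵏ` on `Hᵏ = ∧ᵏH¹`;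
not in the tree), then `φ^*h = 7h` for `h = 7x + φ^*x` — the Weil-compatibility `(√-7)^*E = 7E` that van
Geemen's Lemma 5.2 requires of the polarization. [cite: vanGeemen1994HodgeAV, Lemma 5.2] -/
theorem map_symClass_eq_seven_smul (hφ : φ ≫ φ = -((7 : ℤ) • 𝟙 A))
    (h49 : ∀ x : complexBetti A.X 2, complexBetti.map (-((7 : ℤ) • 𝟙 A)).hom.hom.hom 2 x = (49 : ℂ) • x)
    (e : Motives.ProjectiveEmbedding A.X) (a : complexBetti (Motives.projectiveSpace e.n ℂ) 2) :
    complexBetti.map φ.hom.hom.hom 2 (symClass A φ e a) = (7 : ℂ) • symClass A φ e a := by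
  have hsq : ∀ x : complexBetti A.X 2,
      complexBetti.map φ.hom.hom.hom 2 (complexBetti.map φ.hom.hom.hom 2 x) = (49 : ℂ) • x := fun x => by
    rw [map_map_eq_map_comp, hφ, h49]
  simp only [symClass, map_add, map_smul, hsq, smul_add, smul_smul]
  norm_num
  exact add_comm _ _

/-! ### (d) `IsOfHodgeType 8 A.X 8 4 4 c` — REDUNDANT given hyperbolicity (paper), the abstract core in Lean

Paper argument (new w.r.t. the sixfold crux, where the `(3,3)` hypothesis IS load-bearing).  Let
`V₊ = Eig(φ^*|H¹, i√7)` (`dim 8`; `H¹(A; ℂ) = V₊ ⊕ V₋`, `conj V₊ = V₋`), `P = V₊ ∩ H^{1,0}`, `N = V₊ ∩ H^{0,1}`,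
of dimensions `(k, 8-k)`.  `Q(x, y) = ∫ h⁷ ⌣ x ⌣ y` satisfies `Q(φ^*x, φ^*y) = 7·Q(x, y)` (`φ^*h = 7h`,
`∫ φ^* = deg φ · ∫ = 7⁸ ∫`), so `Q(V₊, V₊) = 0`; `f(x) = i·Q(x, x̄)` is a Hermitian form on `V₊`, and by the
Hodge–Riemann bilinear relations (all of `H¹` is primitive; `h = ±` Kähler because `ι` IS a closed immersion
and `φ` is finite) `±f` is positive definite on `P`, negative definite on `N`, `P ⊥ N`.  A hyperbolic frame
spans `L = L₊ ⊕ L₋`, `conj`-stable (rational) and `φ^*`-stable of `dim 8`, so `dim L₊ = 4`, and `f|L₊ = 0`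
(`x̄ ∈ L` for `x ∈ L₊`, `Q(L, L) = 0`).  The lemma below then forces `k = 4`: the pair `(A, φ)` IS of Weil
type `(4,4)` and `∧⁸V₊ = ∧⁴P ⊗ ∧⁴N ⊂ H^{4,4}` — every class of the typed plane is of type `(4,4)`.
Consequences: (i) the crux minus `IsOfHodgeType` is (paper-)equivalent to the crux; (ii) unlike the sixfold
crux, NO off-type `(A, φ)` (e.g. `E⁸`, `φ = diag √-7`, plane `= H^{8,0} ⊕ H^{0,8}`) satisfies the hypotheses —
the hyperbolicity hypothesis, not the Hodge-type hypothesis, excludes them; (iii) the minimal FALSIFYING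
mutation is the PAIR {drop `IsOfHodgeType`, drop hyperbolicity (or `a ≠ 0`, or the closed-immersion field of
`e`)}: then `E⁸` bites (below, modulo the CM witness). -/

/-- **Signature forcing (abstract core of (d)).**  In a `2k`-dimensional space split as `P ⊕ N` with a
real function `f` positive on `P ∖ 0` and negative on `N ∖ 0`, a `k`-dimensional subspace on which `f`
vanishes forces `dim P = dim N = k`. [cite: vanGeemen1994HodgeAV, Lemma 5.2 (1)] -/
theorem finrank_eq_of_isotropic_half {V : Type*} [AddCommGroup V] [Module ℂ V] [FiniteDimensional ℂ V]
    (P N L : Submodule ℂ V) (f : V → ℝ) (hPN : IsCompl P N)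
    (hP : ∀ x ∈ P, x ≠ 0 → 0 < f x) (hN : ∀ x ∈ N, x ≠ 0 → f x < 0) (hL : ∀ x ∈ L, f x = 0)
    {k : ℕ} (hV : Module.finrank ℂ V = 2 * k) (hLk : Module.finrank ℂ L = k) :
    Module.finrank ℂ P = k ∧ Module.finrank ℂ N = k := by
  have hLP : L ⊓ P = ⊥ := by
    rw [eq_bot_iff]
    intro x hx
    rw [Submodule.mem_bot]
    by_contra h0
    have h1 := hP x hx.2 h0
    rw [hL x hx.1] at h1
    exact lt_irrefl _ h1
  have hLN : L ⊓ N = ⊥ := by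
    rw [eq_bot_iff]
    intro x hx
    rw [Submodule.mem_bot]
    by_contra h0
    have h1 := hN x hx.2 h0
    rw [hL x hx.1] at h1
    exact lt_irrefl _ h1
  have h1 := Submodule.finrank_sup_add_finrank_inf_eq L P
  have h2 := Submodule.finrank_sup_add_finrank_inf_eq L N
  have h3 := Submodule.finrank_sup_add_finrank_inf_eq P N
  rw [hLP, finrank_bot, add_zero] at h1
  rw [hLN, finrank_bot, add_zero] at h2
  rw [hPN.inf_eq_bot, hPN.sup_eq_top, finrank_bot, add_zero, finrank_top] at h3
  have h4 := Submodule.finrank_le (L ⊔ P)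
  have h5 := Submodule.finrank_le (L ⊔ N)
  omega

/-- The crux with `IsOfHodgeType 8 A.X 8 4 4 c` DELETED (believed EQUIVALENT to the crux, (d) above). -/
def CruxWithoutHodgeType : Prop :=
  ∀ (A : Motives.AbelianVariety ℂ) (φ : A ⟶ A), A.dim = 8 → φ ≫ φ = -((7 : ℤ) • 𝟙 A) →
    ∀ (e : Motives.ProjectiveEmbedding A.X) (a : complexBetti (Motives.projectiveSpace e.n ℂ) 2),
      IsRationalClass a → a ≠ 0 → Motives.IsHyperbolicWeilType A φ 4 (symClass A φ e a) →
    ∀ c : complexBetti A.X 8, IsRationalClass c → c ∈ weilPlane8 A φ → c ∈ algebraicClasses A.X 4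

/-- The paper theorem of (d), as the precise `Prop` a future formaliser must supply: on a hyperbolic triple
every rational class of the typed plane is of type `(4,4)` (Hodge–Riemann + `finrank_eq_of_isotropic_half`).
[cite: vanGeemen1994HodgeAV, Lemma 5.2 (1)] [cite: VoisinHodgeI2002, Thm. 6.32] -/
def SignatureForcing : Prop :=
  ∀ (A : Motives.AbelianVariety ℂ) (φ : A ⟶ A), A.dim = 8 → φ ≫ φ = -((7 : ℤ) • 𝟙 A) →
    ∀ (e : Motives.ProjectiveEmbedding A.X) (a : complexBetti (Motives.projectiveSpace e.n ℂ) 2),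
      IsRationalClass a → a ≠ 0 → Motives.IsHyperbolicWeilType A φ 4 (symClass A φ e a) →
    ∀ c : complexBetti A.X 8, IsRationalClass c → c ∈ weilPlane8 A φ → IsOfHodgeType 8 A.X 8 4 4 c

/-- **`IsOfHodgeType` is not load-bearing** (modulo `SignatureForcing`, true on paper): the crux with and
without it coincide. [folklore] -/
theorem cruxWithoutHodgeType_iff (hsig : SignatureForcing) : CruxWithoutHodgeType ↔ HyperbolicEightfoldsSqrtMinus7 := by
  constructor
  · intro h A φ hA hφ e a ha ha0 hyp c hr _ hW
    exact h A φ hA hφ e a ha ha0 hyp c hr hW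
  · intro h A φ hA hφ e a ha ha0 hyp c hr hW
    exact h A φ hA hφ e a ha ha0 hyp c hr (hsig A φ hA hφ e a ha ha0 hyp c hr hW) hW

/-- `RungEight` with `IsOfHodgeType` deleted: "every rational class of the typed plane of EVERY ℚ(√-7)-Weil
eightfold is algebraic" — FALSE on paper (`E⁸`, `φ = diag √-7`: plane `= H^{8,0} ⊕ H^{0,8}`, rational classes
there are not Hodge classes, hence not algebraic). -/
def RungEightWithoutHodgeType : Prop :=
  ∀ (A : Motives.AbelianVariety ℂ) (φ : A ⟶ A), A.dim = 8 → φ ≫ φ = -((7 : ℤ) • 𝟙 A) →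
    ∀ c : complexBetti A.X 8, IsRationalClass c → c ∈ weilPlane8 A φ → c ∈ algebraicClasses A.X 4

/-- The CM witness the tree cannot yet construct: an eightfold `(A, φ)`, `φ² = -7`, with a rational class in
the typed plane that is NOT algebraic (in print: `E⁸`, `E = ℂ/ℤ[(1+√-7)/2]`, `φ = diag(√-7)`, plane of Hodge
types `(8,0)+(0,8)`; NOT hyperbolic for any polarization — signature `(8,0)`). [cite: vanGeemen1994HodgeAV, §5.2–5.3]
[cite: VoisinHodgeI2002, Prop. 11.20] -/
def CMEightfoldNonHodgeWeilWitness : Prop :=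
  ∃ (A : Motives.AbelianVariety ℂ) (φ : A ⟶ A), A.dim = 8 ∧ φ ≫ φ = -((7 : ℤ) • 𝟙 A) ∧
    ∃ c : complexBetti A.X 8, IsRationalClass c ∧ c ∈ weilPlane8 A φ ∧ c ∉ algebraicClasses A.X 4

/-- **The pair drop is fatal** (modulo the CM witness): without BOTH the Hodge-type hypothesis and the
hyperbolicity/polarization block the statement is false. [folklore] -/
theorem rungEightWithoutHodgeType_false_of_witness (hW : CMEightfoldNonHodgeWeilWitness) :
    ¬ RungEightWithoutHodgeType := by
  rintro h
  obtain ⟨A, φ, hdim, hφ, c, hrat, heig, hnot⟩ := hW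
  exact hnot (h A φ hdim hφ c hrat heig)

/-- … and the witness CANNOT bite `CruxWithoutHodgeType`: by `SignatureForcing` its classes would be `(4,4)`,
and then the crux itself would make them algebraic.  (Exact statement: a witness that is moreover hyperbolic
refutes the crux outright — so none is expected.) [folklore] -/
theorem not_crux_of_hyperbolic_witness (hsig : SignatureForcing)
    (hW : ∃ (A : Motives.AbelianVariety ℂ) (φ : A ⟶ A), A.dim = 8 ∧ φ ≫ φ = -((7 : ℤ) • 𝟙 A) ∧
      ∃ (e : Motives.ProjectiveEmbedding A.X) (a : complexBetti (Motives.projectiveSpace e.n ℂ) 2),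
        IsRationalClass a ∧ a ≠ 0 ∧ Motives.IsHyperbolicWeilType A φ 4 (symClass A φ e a) ∧
      ∃ c : complexBetti A.X 8, IsRationalClass c ∧ c ∈ weilPlane8 A φ ∧ c ∉ algebraicClasses A.X 4) :
    ¬ HyperbolicEightfoldsSqrtMinus7 := by
  rintro h
  obtain ⟨A, φ, hdim, hφ, e, a, ha, ha0, hyp, c, hrat, heig, hnot⟩ := hW
  exact hnot (h A φ hdim hφ e a ha ha0 hyp c hrat (hsig A φ hdim hφ e a ha ha0 hyp c hrat heig) heig)

/-! ### (e) Hyperbolicity dropped — back to `RungEight` (all discriminants); the restriction is GENUINE -/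

/-- The crux with the hyperbolicity hypothesis deleted (binders `e, a` kept) is implied by `RungEight`;
conversely it gives `RungEight` as soon as every abelian eightfold has SOME embedding with SOME non-zero
rational class in `H²(ℙᴺ)` (true: `N ≥ 1` and `H²(ℙᴺ(ℂ); ℚ) = ℚ`). [folklore] -/
theorem cruxWithoutHyperbolic_iff_rungEight
    (hH2 : ∀ (A : Motives.AbelianVariety ℂ), A.dim = 8 → ∃ (e : Motives.ProjectiveEmbedding A.X)
      (a : complexBetti (Motives.projectiveSpace e.n ℂ) 2), IsRationalClass a ∧ a ≠ 0) :
    (∀ (A : Motives.AbelianVariety ℂ) (φ : A ⟶ A), A.dim = 8 → φ ≫ φ = -((7 : ℤ) • 𝟙 A) →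
      ∀ (e : Motives.ProjectiveEmbedding A.X) (a : complexBetti (Motives.projectiveSpace e.n ℂ) 2),
        IsRationalClass a → a ≠ 0 →
      ∀ c : complexBetti A.X 8, IsRationalClass c → IsOfHodgeType 8 A.X 8 4 4 c →
        c ∈ weilPlane8 A φ → c ∈ algebraicClasses A.X 4) ↔ RungEight := by
  constructor
  · intro h A φ hA hφ c hr hH hW
    obtain ⟨e, a, ha, ha0⟩ := hH2 A hA
    exact h A φ hA hφ e a ha ha0 c hr hH hW
  · intro h A φ hA hφ e a _ _ c hr hH hW
    exact h A φ hA hφ c hr hH hW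

/-- **The hyperbolic restriction is genuine (arithmetic certificate).**  For `n = 4` the discriminant classes
are `det H = (-1)⁴·a = a`, `a ∈ ℚ_{>0}/Nm(K^×)`, hyperbolic iff `a ≡ 1`; `3 ∉ Nm(ℚ(√-7)^×)` (descent at the inert
prime `3`), so the component `𝓗⁸_3` of ℚ(√-7)-Weil eightfolds (a 16-dimensional family, van Geemen 5.3) is NOT
covered by the crux — only by `RungEight`.  Infinitely many such classes:
`Theorems.WeilTwelvefoldsSqrtMinus7.Negative.discriminantClasses_infinite`. [cite: vanGeemen1994HodgeAV, 5.3–5.4] -/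
theorem three_not_norm : ¬ ∃ a b c : ℤ, c ≠ 0 ∧ (3 : ℤ) * c ^ 2 = a ^ 2 + 7 * b ^ 2 := by
  haveI : Fact (Nat.Prime 3) := ⟨by norm_num⟩
  have h := Theorems.WeilTwelvefoldsSqrtMinus7.Negative.not_norm_of_inert (ℓ := 3)
    (Theorems.WeilTwelvefoldsSqrtMinus7.Negative.not_isSquare_neg_seven (Or.inl rfl)) (m := 1) (by decide)
  simpa using h

/-! ### (d′) CAUTION — (d) is specific to the EMBEDDED typing of `h`; it FAILS for the parent line's Stub 1

`Lines/hyperbolic-eightfold-descent.lean` of the parent crux (stmt-1260) types the transferred crux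
`stub_hyperbolicEightfolds` with a GENERAL class `h`: rational, `h ∈ N¹H²` (divisor class), `ψ^*h = 7h`,
`Q_h` non-degenerate, hyperbolic — NOT necessarily `±` ample.  For such `h` the signature is NOT forced:
on `X = E⁸` (`E` CM by `O_K`), `ψ = diag(√-7)` (Weil signature `(8,0)`, plane `= H^{8,0} ⊕ H^{0,8}`), EVERY
divisor class is `ψ`-compatible (`NS(E⁸)_ℚ ≅ Herm₈(K)`, `ψ` central), and an INDEFINITE non-singular
Hermitian `M` of signature `(4,4)` gives a divisor class `h_M` with `Q_{h_M}` non-degenerate and a `K`-stable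
rational Lagrangian (`M`-isotropic `K⁴ ⊂ K⁸`): all of Stub 1's hypotheses on `h` hold, yet the rational
classes of the plane are of type `(8,0)+(0,8)`, not algebraic.  So Stub 1 MINUS `IsOfHodgeType` is FALSE
(paper), while the crux minus `IsOfHodgeType` is equivalent to the crux: the closed-immersion field of
`ProjectiveEmbedding` (positivity of `h`, Hodge–Riemann) is exactly what (d) consumes.  Stub 1 itself (with
the `(4,4)` clause) is unaffected — vacuous on that witness. -/

/-- Stub 1 of the parent line with its Hodge-type clause deleted (to pin the caution above). -/
def StubOneWithoutHodgeType : Prop :=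
  ∀ (X : Motives.AbelianVariety ℂ) (ψ : X ⟶ X), X.dim = 8 → ψ ≫ ψ = -((7 : ℤ) • 𝟙 X) →
    ∀ h : complexBetti X.X 2, IsRationalClass h → h ∈ algebraicClasses X.X 1 →
      complexBetti.map ψ.hom.hom.hom 2 h = (7 : ℂ) • h →
      (∀ x : complexBetti X.X 1,
        (∀ y : complexBetti X.X 1, Motives.polarizationPairingOne X.X h 7 x y = 0) → x = 0) →
      Motives.IsHyperbolicWeilType X ψ 4 h →
    ∀ c : complexBetti X.X 8, IsRationalClass c → c ∈ weilPlane8 X ψ → c ∈ algebraicClasses X.X 4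

/-- The CM witness with an INDEFINITE hyperbolic divisor class (`E⁸`, `diag √-7`, `h_M`, `M ∈ Herm₈(K)`
non-singular of signature `(4,4)`): all of Stub 1's hypotheses on `h`, a rational non-algebraic class in the
plane.  Not constructible in the tree; believed TRUE. [cite: vanGeemen1994HodgeAV, §5.2–5.3]
[cite: LangeBirkenhake1992, Prop. 5.2.1 and Thm. 5.2.4] -/
def CMEightfoldIndefiniteDivisorWitness : Prop :=
  ∃ (X : Motives.AbelianVariety ℂ) (ψ : X ⟶ X), X.dim = 8 ∧ ψ ≫ ψ = -((7 : ℤ) • 𝟙 X) ∧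
    ∃ h : complexBetti X.X 2, IsRationalClass h ∧ h ∈ algebraicClasses X.X 1 ∧
      complexBetti.map ψ.hom.hom.hom 2 h = (7 : ℂ) • h ∧
      (∀ x : complexBetti X.X 1,
        (∀ y : complexBetti X.X 1, Motives.polarizationPairingOne X.X h 7 x y = 0) → x = 0) ∧
      Motives.IsHyperbolicWeilType X ψ 4 h ∧
    ∃ c : complexBetti X.X 8, IsRationalClass c ∧ c ∈ weilPlane8 X ψ ∧ c ∉ algebraicClasses X.X 4

/-- **Stub 1 minus its Hodge-type clause is false** (modulo the indefinite CM witness) — in contrast with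
`cruxWithoutHodgeType_iff`. [folklore] -/
theorem stubOneWithoutHodgeType_false_of_witness (hW : CMEightfoldIndefiniteDivisorWitness) :
    ¬ StubOneWithoutHodgeType := by
  rintro h
  obtain ⟨X, ψ, hdim, hψ, h2, hr2, hN1, hcompat, hnd, hyp, c, hrat, heig, hnot⟩ := hW
  exact hnot (h X ψ hdim hψ h2 hr2 hN1 hcompat hnd hyp c hrat heig)

end LoadBearing

/-! ## §4 Relation to the registered stub of the parent crux ("up to the polarization typing")

The item says the crux "is, up to the polarization typing, `stub_hyperbolicEightfolds`" of the parent's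
registered skeleton.  Precisely: Stub 1 quantifies over a MORE GENERAL `h`, so Stub 1 ⟹ crux needs, for the
crux's `h(e, a)`, exactly three tree facts not available today — (N1) `h(e,a) ∈ N¹H²(A)` (`ι^*a` is a
hyperplane-section class; `φ^*` of it needs flat pull-back or a moving lemma), (C) `φ^*h = 7h` (`[-7]^* = 49`
on `H²`, §3(c)), (ND) `Q_h` non-degenerate on `H¹` (hard Lefschetz for `h⁷`, `h = ±` ample) — plus
rationality of pull-backs (`IsRationalClass.map`, in the tree).  The converse crux ⟹ Stub 1 is NOT formal
(Stub 1's `h` need not be `±` ample: §3(d′)).  Recorded so that whoever glues the two knows the bill. -/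

section ParentStub

/-- Stub 1 of `Lines/hyperbolic-eightfold-descent.lean` (parent crux stmt-1260), verbatim as a `Prop`. -/
def StubHyperbolicEightfolds : Prop :=
  ∀ (X : Motives.AbelianVariety ℂ) (ψ : X ⟶ X), X.dim = 8 → ψ ≫ ψ = -((7 : ℤ) • 𝟙 X) →
    ∀ h : complexBetti X.X 2, IsRationalClass h → h ∈ algebraicClasses X.X 1 →
      complexBetti.map ψ.hom.hom.hom 2 h = (7 : ℂ) • h →
      (∀ x : complexBetti X.X 1,
        (∀ y : complexBetti X.X 1, Motives.polarizationPairingOne X.X h 7 x y = 0) → x = 0) →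
      Motives.IsHyperbolicWeilType X ψ 4 h →
    ∀ c : complexBetti X.X 8, IsRationalClass c → IsOfHodgeType 8 X.X 8 4 4 c →
      c ∈ weilPlane8 X ψ → c ∈ algebraicClasses X.X 4

/-- **Stub 1 ⟹ crux, given the three typing facts (N1), (C), (ND) for the embedded class `h(e, a)`.**
Pure logic; the three hypotheses are the exact bill of "up to the polarization typing". [folklore] -/
theorem crux_of_stubOne (hstub : StubHyperbolicEightfolds)
    (hN1 : ∀ (A : Motives.AbelianVariety ℂ) (φ : A ⟶ A) (e : Motives.ProjectiveEmbedding A.X)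
      (a : complexBetti (Motives.projectiveSpace e.n ℂ) 2), IsRationalClass a →
      symClass A φ e a ∈ algebraicClasses A.X 1)
    (hC : ∀ (A : Motives.AbelianVariety ℂ) (φ : A ⟶ A), φ ≫ φ = -((7 : ℤ) • 𝟙 A) →
      ∀ (e : Motives.ProjectiveEmbedding A.X) (a : complexBetti (Motives.projectiveSpace e.n ℂ) 2),
      complexBetti.map φ.hom.hom.hom 2 (symClass A φ e a) = (7 : ℂ) • symClass A φ e a)
    (hND : ∀ (A : Motives.AbelianVariety ℂ) (φ : A ⟶ A), A.dim = 8 → φ ≫ φ = -((7 : ℤ) • 𝟙 A) →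
      ∀ (e : Motives.ProjectiveEmbedding A.X) (a : complexBetti (Motives.projectiveSpace e.n ℂ) 2),
      IsRationalClass a → a ≠ 0 → ∀ x : complexBetti A.X 1,
        (∀ y : complexBetti A.X 1, Motives.polarizationPairingOne A.X (symClass A φ e a) 7 x y = 0) → x = 0) :
    HyperbolicEightfoldsSqrtMinus7 := by
  intro A φ hA hφ e a ha ha0 hyp c hr hH hW
  have hx : IsRationalClass (complexBetti.map e.ι 2 a) := ha.map _
  have h1 : IsRationalClass ((7 : ℂ) • complexBetti.map e.ι 2 a) := by simpa using hx.smul 7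
  have hrat : IsRationalClass (symClass A φ e a) := h1.add (hx.map _)
  exact hstub A φ hA hφ (symClass A φ e a) hrat (hN1 A φ e a ha) (hC A φ hφ e a) (hND A φ hA hφ e a ha ha0)
    hyp c hr hH hW

end ParentStub

end Summit.HodgeConjecture.HodgeConjecture.Cruxes.HyperbolicEightfoldsSqrtMinus7.Disproof

end
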